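import Summits.AnomalousDissipation.AnomalousDissipation.Theorems.SolenoidalFractalHomogenisationLagrangianStepVmodFsPhaseWindow
import HarnessLib

/-!
# K1L_D (stmt-AnomalousDissipation-27980): (V_mod) flat stage, block (fs) — THE ROW ASSEMBLER: per-label leak rows in the allowance currency
# `ε_ℓ ≤ alw·√(dW ℓ)·‖v‖` give the (fs) pairing bound `2·alw·√lossFwd·√lossAdj`
(helper; `--supports 27980 --as helper`; prover ad-k1loc-p3 g10; the abstract form of the assembly step used in `…VmodFsPhaseWindow`,
`…VmodFsPeriodWindow`, `…VmodFsHighRow`: engine `abs_inner_sub_le_sqrt_of_fast_modewise` (p713117) + currency `sum_weight_le_lossAdj`,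
`lossFwd_ge_of_supp`.)

* `dW_le_sqrt_dW` — `0 ≤ dW ≤ 1`, hence `dW ≤ √dW` (rows stated with `dW`, e.g. `VmodGen.leak_le_alw_of_scale_iter_fast`, feed the assembler too).
* **`fs_pairing_le_of_rows`** — for a fast datum `x`, a mean-free slow test `ζ`, a window beyond the fast saturation time, and ANY `alw ≥ 0` such that
  every nonzero slow label `ℓ ∈ freqBall(n/4)` and every weakly divergence-free fast member `v` of the class pair of `ℓ` satisfy the ROW
  `‖𝓕(U s t v)(ℓ)‖ ≤ alw·√(dW lo Λ c ν n (t−s) ℓ)·‖v‖`:   `|⟪U s t x − T s t x, ζ⟫| ≤ 2·alw·√(lossFwd (T s t) x)·√(lossAdj (T s t) ζ)`.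
  No phase hypothesis here: the phase lives in whichever rows are used to discharge `hrow` (coarse: `…VmodFsMidRow`, `…VmodFsIterRow`; high:
  `…VmodFsHighAnyPhase`; floor/short: trivial and generator rows).  With `alw = C₃(C₃(ν^e + (⌈K/ν⌉₊/n)^e) + (min 1 (P/τ))^e)/2` this is
  literally the `BlockBound` inequality of `Bfs_textEVH`.
`sorry`-free; NOT a proof of (fs), of the stub, of K1L_D or of AD; rung F-D1.A0.
-/

set_option linter.dupNamespace false

noncomputable section

namespace Summit.AnomalousDissipation.AnomalousDissipation.Theorems.SolenoidalFractalHomogenisation.LagrangianStep.VmodFlat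

open Literature.Analysis Literature.Analysis.FluidPDE Literature.Analysis.FunctionSpaces
open MeasureTheory Set Filter UnitAddTorus
open scoped ENNReal NNReal InnerProductSpace
open Summit.AnomalousDissipation.AnomalousDissipation.Theorems.SolenoidalFractalHomogenisation.LagrangianStep.CellClauseMod
open Summit.AnomalousDissipation.AnomalousDissipation.Theorems.SolenoidalFractalHomogenisation.LagrangianStep.LossCurrency
open Summit.AnomalousDissipation.AnomalousDissipation.Theorems.SolenoidalFractalHomogenisation.RealisedQuasiStaticCellLaw
  (isSmooth_cell isDivFree_cell memLp_top_stLift_cell)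

/-- The slow dissipation weight lies in `[0,1]`, so `dW ≤ √dW`. -/
theorem dW_le_sqrt_dW (lo Λ c ν : ℝ) (n : ℕ) (τ : ℝ) (ℓ : Fin 3 → ℤ) (hloT : 0 ≤ loT lo Λ c ν n) (hτ : 0 ≤ τ) :
    dW lo Λ c ν n τ ℓ ≤ Real.sqrt (dW lo Λ c ν n τ ℓ) := by
  have hq := Torus.freqNormSq_nonneg ℓ
  have h0 : 0 ≤ dW lo Λ c ν n τ ℓ := by
    unfold dW
    have : Real.exp (-(8 * Real.pi ^ 2 * loT lo Λ c ν n * Torus.freqNormSq ℓ * τ)) ≤ 1 :=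
      Real.exp_le_one_iff.2 (by
        have : 0 ≤ 8 * Real.pi ^ 2 * loT lo Λ c ν n * Torus.freqNormSq ℓ * τ := by positivity
        linarith)
    linarith
  have h1 : dW lo Λ c ν n τ ℓ ≤ 1 := by
    unfold dW; have := Real.exp_pos (-(8 * Real.pi ^ 2 * loT lo Λ c ν n * Torus.freqNormSq ℓ * τ)); linarith
  calc dW lo Λ c ν n τ ℓ = Real.sqrt (dW lo Λ c ν n τ ℓ) * Real.sqrt (dW lo Λ c ν n τ ℓ) := (Real.mul_self_sqrt h0).symm
    _ ≤ Real.sqrt (dW lo Λ c ν n τ ℓ) * 1 :=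
        mul_le_mul_of_nonneg_left (by rw [← Real.sqrt_one]; exact Real.sqrt_le_sqrt h1) (Real.sqrt_nonneg _)
    _ = _ := mul_one _

set_option maxHeartbeats 1600000 in
/-- **THE (fs) ROW ASSEMBLER.**  See the module docstring. -/
theorem fs_pairing_le_of_rows {k : ℕ} (W : LatticeShear.LatticeWord k) (M : ℝ) (hM : 0 < M) {c : ℝ} (hc : 0 < c)
    (Φ : ℝ → Torus.Visc4 (Fin 3) → Torus.Visc4 (Fin 3)) {lo hi Λ ν₀ K : ℝ}
    (hlo : 0 < lo) (hhi : 1 ≤ hi) (hΛ : 1 < Λ) (hK : 0 < K)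
    {ν : ℝ} (hν : ν ∈ Set.Ioo 0 ν₀) {n : ℕ} (hn : (⌈K / ν⌉₊ : ℝ) ≤ n) {𝔸 : Torus.Visc4 (Fin 3)}
    (hwin : ∃ lam ∈ Set.Icc (1:ℝ) Λ, Torus.NearIso 𝔸 (ν * (lo / lam)) (ν * (hi * lam)))
    (hΦw : ∃ lam ∈ Set.Icc (1:ℝ) Λ, Torus.NearIso (Φ ν ((1 / ν) • 𝔸)) (lo / lam) (hi * lam))
    {Tw : ℝ} {U T : ℝ → ℝ → (V2 →L[ℝ] V2)}
    (hU : Torus.IsPropagator Tw (cellField W M hM ν hν.1 n) ((1 / (n:ℝ) ^ 2) • 𝔸) U)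
    (hT : Torus.IsPropagator Tw (fun _ _ => 0) ((1 / (n:ℝ) ^ 2) • (𝔸 + (c / ν) • Φ ν ((1 / ν) • 𝔸))) T)
    {s t : ℝ} (hs : 0 ≤ s) (hst : s < t) (htT : t ≤ Tw)
    (x ζ : V2) (hx : IsFast n x) (hζ : IsSlowNZ n ζ)
    (hsat : 1 ≤ 8 * Real.pi ^ 2 * loT lo Λ c ν n * ((n / 4 : ℕ) : ℝ) ^ 2 * (t - s))
    {alw : ℝ} (halw : 0 ≤ alw)
    (hrow : ∀ ℓ ∈ (Torus.freqBall (d := Fin 3) (n / 4)).erase 0, ∀ v : V2, v ∈ Torus.divFreeL2 (Fin 3) →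
      (∀ k', ¬ ((∀ i, (n:ℤ) ∣ k' i - ℓ i) ∨ (∀ i, (n:ℤ) ∣ k' i + ℓ i)) → fc v k' = 0) → fc v ℓ = 0 → fc v (-ℓ) = 0 →
      ‖fc (U s t v) ℓ‖ ≤ alw * Real.sqrt (dW lo Λ c ν n (t - s) ℓ) * ‖v‖) :
    |⟪U s t x - T s t x, ζ⟫_ℝ| ≤ 2 * alw * Real.sqrt (lossFwd (T s t) x) * Real.sqrt (lossAdj (T s t) ζ) := by
  classical
  have hn1 : (1:ℝ) ≤ n := by
    have h1 : (1:ℝ) ≤ ⌈K / ν⌉₊ := by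
      have : 0 < K / ν := div_pos hK hν.1
      exact_mod_cast Nat.one_le_iff_ne_zero.2 (Nat.pos_iff_ne_zero.1 (Nat.ceil_pos.2 this))
    exact h1.trans hn
  have hnpos : 0 < n := by exact_mod_cast (show (0:ℝ) < n by linarith)
  have hn0 : (0:ℝ) < n := by exact_mod_cast hnpos
  have hν0 : 0 < ν := hν.1
  have hΛ0 : 0 < Λ := by linarith
  have hΛ1 : 1 ≤ Λ := hΛ.le
  have hhi0 : 0 ≤ hi := by linarith
  have hts : 0 < t - s := sub_pos.2 hst
  have hsT : s < Tw := lt_of_lt_of_le hst htT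
  set N₄ : ℕ := n / 4 with hN₄
  set S : Finset (Fin 3 → ℤ) := (Torus.freqBall (d := Fin 3) (n / 4)).erase 0 with hS
  have hLN : 2 * (n / 4) < n := by omega
  obtain ⟨lam, hlam, hA𝔸⟩ := hwin
  obtain ⟨lam', hlam', hΦn⟩ := hΦw
  have hlam0 : 0 < lam := by linarith [hlam.1]
  have hlam'0 : 0 < lam' := by linarith [hlam'.1]
  have hcν : 0 ≤ c / ν := div_nonneg hc.le hν0.le
  have hn2 : (0:ℝ) < 1 / (n:ℝ) ^ 2 := by positivity
  have hAΛ : Torus.NearIso 𝔸 (ν * (lo / Λ)) (ν * (hi * Λ)) :=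
    hA𝔸.mono (mul_le_mul_of_nonneg_left (div_le_div_of_nonneg_left hlo.le hlam0 hlam.2) hν0.le)
      (mul_le_mul_of_nonneg_left (mul_le_mul_of_nonneg_left hlam.2 hhi0) hν0.le)
  have hloA : 0 < ν * (lo / Λ) := mul_pos hν0 (div_pos hlo hΛ0)
  have hcell : Torus.NearIso ((1 / (n:ℝ) ^ 2) • 𝔸) ((1 / (n:ℝ) ^ 2) * (ν * (lo / Λ))) ((1 / (n:ℝ) ^ 2) * (ν * (hi * Λ))) := hAΛ.smul hn2.le
  have hcell_lo : 0 < (1 / (n:ℝ) ^ 2) * (ν * (lo / Λ)) := mul_pos hn2 hloA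
  have hcoarse0 : Torus.NearIso ((1 / (n:ℝ) ^ 2) • (𝔸 + (c / ν) • Φ ν ((1 / ν) • 𝔸)))
      ((1 / (n:ℝ) ^ 2) * (ν * (lo / lam) + (c / ν) * (lo / lam'))) ((1 / (n:ℝ) ^ 2) * (ν * (hi * lam) + (c / ν) * (hi * lam'))) :=
    (hA𝔸.add (hΦn.smul hcν)).smul hn2.le
  have hloT_le : loT lo Λ c ν n ≤ (1 / (n:ℝ) ^ 2) * (ν * (lo / lam) + (c / ν) * (lo / lam')) := by
    unfold loT
    have h1 : lo / Λ ≤ lo / lam := div_le_div_of_nonneg_left hlo.le hlam0 hlam.2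
    have h2 : lo / Λ ≤ lo / lam' := div_le_div_of_nonneg_left hlo.le hlam'0 hlam'.2
    have h3 : (ν + c / ν) * (lo / Λ) ≤ ν * (lo / lam) + (c / ν) * (lo / lam') := by
      have := mul_le_mul_of_nonneg_left h1 hν0.le
      have := mul_le_mul_of_nonneg_left h2 hcν
      nlinarith
    exact mul_le_mul_of_nonneg_left h3 hn2.le
  have hloT : 0 < loT lo Λ c ν n := by
    unfold loT
    have hνc : 0 < ν + c / ν := by positivity
    exact mul_pos hn2 (mul_pos hνc (div_pos hlo hΛ0))
  have hcoarse : Torus.NearIso ((1 / (n:ℝ) ^ 2) • (𝔸 + (c / ν) • Φ ν ((1 / ν) • 𝔸)))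
      (loT lo Λ c ν n) ((1 / (n:ℝ) ^ 2) * (ν * (hi * lam) + (c / ν) * (hi * lam'))) := hcoarse0.mono hloT_le le_rfl
  set L : ℝ := loT lo Λ c ν n with hLdef
  have hLc : (c / ν) * (lo / Λ) / (n:ℝ) ^ 2 ≤ L := by
    rw [hLdef]; unfold loT
    rw [div_eq_mul_one_div ((c / ν) * (lo / Λ)) ((n:ℝ) ^ 2), mul_comm ((c / ν) * (lo / Λ))]
    refine mul_le_mul_of_nonneg_left ?_ hn2.le
    have : 0 ≤ ν * (lo / Λ) := by positivity
    nlinarith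
  have hbU : MemLp (Torus.stLift (cellField W M hM ν hν.1 n)) ∞ (volume.restrict (Ioo 0 Tw ×ˢ (univ : Set (EuclideanSpace ℝ (Fin 3))))) :=
    memLp_top_stLift_cell _ n Tw
  have hbUdiv : ∀ᵐ τ ∂(volume.restrict (Ioo (0:ℝ) Tw)), Torus.IsWeaklyDivFree (cellField W M hM ν hν.1 n τ) :=
    ae_of_all _ fun τ => (isDivFree_cell _ n τ).isWeaklyDivFree_holds (isSmooth_cell _ n τ)
  have hgrid : ∀ (j : Fin 3 → Fin n) (τ : ℝ) (y : UnitAddTorus (Fin 3)),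
      cellField W M hM ν hν.1 n τ (y + (fun i => ((((j i : ℕ) : ℝ) / n : ℝ) : UnitAddCircle))) = cellField W M hM ν hν.1 n τ y :=
    fun j τ y => by unfold cellField; exact cell_add_grid _ hnpos j τ y
  have hUcl : ∀ (c' : Fin 3 → ℤ) (y : V2), (∀ k', ((∀ i, (n:ℤ) ∣ k' i - c' i) ∨ (∀ i, (n:ℤ) ∣ k' i + c' i)) →
        mFourierCoeff (EuclideanSpace.complexify ∘ ⇑y) k' = 0) →
      ∀ k', ((∀ i, (n:ℤ) ∣ k' i - c' i) ∨ (∀ i, (n:ℤ) ∣ k' i + c' i)) →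
        mFourierCoeff (EuclideanSpace.complexify ∘ ⇑(U s t y)) k' = 0 :=
    fun c' y hy k' hk' => PropagatorSymm.fcoeff_apply_eq_zero_of_classes hU hcell hcell_lo hbU hbUdiv hnpos hgrid c' hs hst.le htT y hy k' hk'
  have hTmode : ∀ (y : V2) (k' : Fin 3 → ℤ), mFourierCoeff (EuclideanSpace.complexify ∘ ⇑y) k' = 0 →
      mFourierCoeff (EuclideanSpace.complexify ∘ ⇑(T s t y)) k' = 0 :=
    fun y k' hk' => fc_propagator_eq_zero hcoarse hloT (fun _ _ => rfl) hT hs hst.le htT y hk'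
  have halone : ∀ ℓ ∈ S, ∀ k' ∈ S, ((∀ i, (n:ℤ) ∣ k' i - ℓ i) ∨ (∀ i, (n:ℤ) ∣ k' i + ℓ i)) → k' = ℓ ∨ k' = -ℓ :=
    fun ℓ hℓ k' hk' hpair => FlatWindow.alone_of_lt hLN (Finset.mem_of_mem_erase hℓ) (Finset.mem_of_mem_erase hk') hpair
  have hnsc : ∀ ℓ ∈ S, ¬ (∀ i, (n:ℤ) ∣ ℓ i + ℓ i) :=
    fun ℓ hℓ => FlatWindow.not_selfConj_of_lt hLN (Finset.mem_of_mem_erase hℓ) (Finset.ne_of_mem_erase hℓ)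
  have hSneg : ∀ k' ∈ S, -k' ∈ S := fun k' hk' =>
    Finset.mem_erase.2 ⟨neg_ne_zero.2 (Finset.ne_of_mem_erase hk'), Torus.neg_mem_freqBall.2 (Finset.mem_of_mem_erase hk')⟩
  set ε : (Fin 3 → ℤ) → ℝ := fun ℓ => alw * Real.sqrt (dW lo Λ c ν n (t - s) ℓ) with hεdef
  have hε0 : ∀ ℓ, 0 ≤ ε ℓ := fun ℓ => by rw [hεdef]; positivity
  have hleak : ∀ ℓ ∈ S, ∀ v : V2, v ∈ Torus.divFreeL2 (Fin 3) →
      (∀ k', ¬ ((∀ i, (n:ℤ) ∣ k' i - ℓ i) ∨ (∀ i, (n:ℤ) ∣ k' i + ℓ i)) → mFourierCoeff (EuclideanSpace.complexify ∘ ⇑v) k' = 0) →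
      mFourierCoeff (EuclideanSpace.complexify ∘ ⇑v) ℓ = 0 → mFourierCoeff (EuclideanSpace.complexify ∘ ⇑v) (-ℓ) = 0 →
      ‖mFourierCoeff (EuclideanSpace.complexify ∘ ⇑(U s t v)) ℓ‖ ≤ ε ℓ * ‖v‖ :=
    fun ℓ hℓ v hv hvs hv1 hv2 => hrow ℓ hℓ v hv hvs hv1 hv2
  set d : (Fin 3 → ℤ) → ℝ := fun ℓ => dW lo Λ c ν n (t - s) ℓ with hddef
  have hd0 : ∀ ℓ, 0 ≤ d ℓ := fun ℓ => by
    rw [hddef]; unfold dW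
    have : Real.exp (-(8 * Real.pi ^ 2 * loT lo Λ c ν n * Torus.freqNormSq ℓ * (t - s))) ≤ 1 := by
      apply Real.exp_le_one_iff.2
      have := Torus.freqNormSq_nonneg ℓ
      have : 0 ≤ 8 * Real.pi ^ 2 * loT lo Λ c ν n * Torus.freqNormSq ℓ * (t - s) := by positivity
      linarith
    linarith
  have hεd : ∀ ℓ ∈ S, ε ℓ ≤ alw * Real.sqrt (d ℓ) := fun ℓ _ => le_rfl
  have hxS : ∀ k' ∈ S, mFourierCoeff (EuclideanSpace.complexify ∘ ⇑x) k' = 0 := fun k' hk' => hx k' (Finset.mem_of_mem_erase hk')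
  have hζS : ∀ k', k' ∉ S → mFourierCoeff (EuclideanSpace.complexify ∘ ⇑ζ) k' = 0 := fun k' hk' => hζ k' hk'
  have key := abs_inner_sub_le_sqrt_of_fast_modewise S (U s t) (T s t) ε hnpos hSneg halone hnsc hε0
    (fun y => hU.apply_eq_apply_starProjection s t y) (fun y => hT.apply_eq_apply_starProjection s t y)
    hUcl hTmode hleak d alw halw hd0 hεd x ζ hxS hζS
  have hAζ : ∑ k' ∈ S, d k' * ‖mFourierCoeff (EuclideanSpace.complexify ∘ ⇑ζ) k'‖ ^ 2 ≤ lossAdj (T s t) ζ :=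
    sum_weight_le_lossAdj hcoarse hloT hT hs hst.le htT S ζ
  have hFx : (1 / 2) * ‖x‖ ^ 2 ≤ lossFwd (T s t) x := by
    have hsupp : ∀ k', fc x k' ≠ 0 → ((N₄ : ℝ)) ^ 2 ≤ Torus.freqNormSq k' := by
      intro k' hk'
      by_contra hlt
      exact hk' (hx k' (Torus.mem_freqBall.2 (le_of_lt (not_le.1 hlt))))
    have h := lossFwd_ge_of_supp hcoarse hloT (fun _ _ => rfl) hT hs hst.le htT x (sq_nonneg (N₄ : ℝ)) hsupp
    have he : (1:ℝ) / 2 ≤ 1 - Real.exp (-(8 * Real.pi ^ 2 * L * (N₄:ℝ) ^ 2 * (t - s))) := half_le_one_sub_exp_neg_of_one_le hsat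
    exact (mul_le_mul_of_nonneg_right he (sq_nonneg _)).trans h
  have hxle : ‖x‖ ≤ Real.sqrt 2 * Real.sqrt (lossFwd (T s t) x) := by
    rw [← Real.sqrt_mul (by norm_num)]
    calc ‖x‖ = Real.sqrt (‖x‖ ^ 2) := (Real.sqrt_sq (norm_nonneg _)).symm
      _ ≤ Real.sqrt (2 * lossFwd (T s t) x) := Real.sqrt_le_sqrt (by linarith)
  refine key.trans ?_
  have hs2 : Real.sqrt 2 * Real.sqrt 2 = 2 := Real.mul_self_sqrt (by norm_num)
  calc Real.sqrt 2 * alw * ‖x‖ * Real.sqrt (∑ k' ∈ S, d k' * ‖mFourierCoeff (EuclideanSpace.complexify ∘ ⇑ζ) k'‖ ^ 2)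
      ≤ Real.sqrt 2 * alw * (Real.sqrt 2 * Real.sqrt (lossFwd (T s t) x)) * Real.sqrt (lossAdj (T s t) ζ) :=
        mul_le_mul (mul_le_mul_of_nonneg_left hxle (by positivity)) (Real.sqrt_le_sqrt hAζ) (Real.sqrt_nonneg _) (by positivity)
    _ = 2 * alw * Real.sqrt (lossFwd (T s t) x) * Real.sqrt (lossAdj (T s t) ζ) := by
        rw [show Real.sqrt 2 * alw * (Real.sqrt 2 * Real.sqrt (lossFwd (T s t) x)) = (Real.sqrt 2 * Real.sqrt 2) * alw * Real.sqrt (lossFwd (T s t) x) by ring, hs2]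

end Summit.AnomalousDissipation.AnomalousDissipation.Theorems.SolenoidalFractalHomogenisation.LagrangianStep.VmodFlat

end
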